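import Mathlib
import Summits.Ventures.HodgeRepro2.Tier7.Line3.DominantSideOfKappa
import Summits.Ventures.HodgeRepro2.Tier7.Line3.KappaIsolation

/-!
# Tier7/Line3/KappaSingularExcluded — the two singular double cosets leave the level-`N` support (seat t7-L1-p4, gen 4)

LINE 3 (t7-plan-3), version (ii); REPAIR CENSUS §C item U4 (route/t7/Line3/REPAIR-CENSUS.md, STATUS l. 15496; assigned
to this seat by the t7-lead l. 15499 / l. 15512): memo v18 §2a — «REGULAR double cosets: `κ ∉ {0, 1}` (for `κ = 0`,
`γ W₂ = W₁`, and for `κ = 1`, `γ W₂ = W₀`: the stabiliser … is then positive-dimensional modulo the centre)» — and the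
census: «the SINGULAR double cosets `κ ∈ {0, 1}` … eventually outside `T_A K_N T_B` at `v₁` unless `κ(γ) = κ(γ₀)`
(KappaIsolation p678820 covers the κ-half); a one-line corollary: the two singular cosets are excluded by the
κ-congruence for `N` large». t7-crit-2 l. 15251 ADDITION 1 lists «the singular classes (`κ ∈ {0, 1}`) handled
separately» among the [W] items of the identity row. THIS FILE makes that clause a kernel row on the model:

* CORE (`exists_threshold`, `ne_zero_and_ne_one_of_le_pow`, Mathlib only): for an absolute value `v` on a field, `1 < q`
  and a REGULAR value `κ₀ ∉ {0, 1}`, there is `N₀` such that for `N ≥ N₀` every `x` with `v (x − κ₀) ≤ q⁻¹ ^ N` has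
  `x ≠ 0 ∧ x ≠ 1` (`q⁻¹ ^ N → 0` below `min (v κ₀) (v (κ₀ − 1)) > 0`);
* COROLLARY on the κ-dictionary (`KappaData.exists_regular_of_arith`): for `D : KappaData` whose dominant coset is
  regular, `D.κ D.γ₀ ≠ 0 ∧ D.κ D.γ₀ ≠ 1`, there is `N₀` with `∀ N ≥ N₀, ∀ γ, D.arith N γ → D.κ γ ≠ 0 ∧ D.κ γ ≠ 1` —
  from the field `hcong` alone (`|κ γ − κ γ₀|_{v₁} ≤ q^{−N}` on the level-`N` support): the two singular double cosets
  are outside the support for `N` large, so every term of the geometric side at level `N ≥ N₀` is a REGULAR class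
  (`KappaData.arith_regular_eventually`);
* the same through `KappaIsolation`'s local reading of regularity (`exists_regular_of_map_kappa_le_pow`): for the
  matrix-level invariant `kappa σ d f γ` read in a completion `ψ : E →+* E′` with an absolute value `abv` on `E′` and an
  `hloc`-shaped bound `abv (ψ (κ γ) − ψ (κ γ₀)) ≤ q⁻¹ ^ N`, the GLOBAL regularity `kappa σ d f γ ≠ 0 ∧ ≠ 1` for `N ≥ N₀`
  (`KappaIsolation.map_kappa_ne_zero_iff` / `map_kappa_ne_one_iff`, p678820, by name).

What stays in words (the dictionary): that the level-`N` support of the real `f_{v₁}` satisfies `hcong` for the real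
`κ` (KappaData's field, x1's `KappaCongruence`), and the regularity of the real `γ₀` (a choice on an open dense locus,
(b′)). Nothing about the real `X`, an automorphic form, (N) or (P); no device; §8(d): NO. No sorry; axioms ⊆
{propext, Classical.choice, Quot.sound}.
-/

namespace Summit.Ventures.HodgeRepro2.Tier7.Line3.KappaSingularExcluded

open Filter Topology

section Core

variable {K : Type*} [Field K] (v : AbsoluteValue K ℝ)

/-- `q⁻¹ ^ N` is eventually below any positive threshold. -/
lemma exists_pow_lt {q : ℝ} (hq : 1 < q) {δ : ℝ} (hδ : 0 < δ) : ∃ N₀ : ℕ, ∀ N ≥ N₀, q⁻¹ ^ N < δ := by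
  have h0 : (0 : ℝ) ≤ q⁻¹ := inv_nonneg.mpr (by linarith)
  have h1 : q⁻¹ < 1 := inv_lt_one_of_one_lt₀ hq
  have := (tendsto_pow_atTop_nhds_zero_of_lt_one h0 h1).eventually_lt_const hδ
  exact Filter.eventually_atTop.mp this

/-- the regular threshold: below `min (v κ₀) (v (κ₀ − 1))`, which is positive for `κ₀ ∉ {0, 1}`. -/
lemma exists_threshold {q : ℝ} (hq : 1 < q) {κ₀ : K} (h0 : κ₀ ≠ 0) (h1 : κ₀ ≠ 1) :
    ∃ N₀ : ℕ, ∀ N ≥ N₀, q⁻¹ ^ N < v κ₀ ∧ q⁻¹ ^ N < v (κ₀ - 1) := by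
  have hκ0 : 0 < v κ₀ := v.pos_iff.mpr h0
  have hκ1 : 0 < v (κ₀ - 1) := v.pos_iff.mpr (sub_ne_zero.mpr h1)
  obtain ⟨N₀, hN₀⟩ := exists_pow_lt hq (lt_min hκ0 hκ1)
  exact ⟨N₀, fun N hN => ⟨lt_of_lt_of_le (hN₀ N hN) (min_le_left _ _),
    lt_of_lt_of_le (hN₀ N hN) (min_le_right _ _)⟩⟩

/-- an `x` within `q⁻¹ ^ N` of a regular `κ₀` is regular, once `q⁻¹ ^ N` is below the threshold. -/
lemma ne_zero_and_ne_one_of_le_pow {q : ℝ} {N : ℕ} {κ₀ x : K}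
    (hthr : q⁻¹ ^ N < v κ₀ ∧ q⁻¹ ^ N < v (κ₀ - 1)) (hx : v (x - κ₀) ≤ q⁻¹ ^ N) :
    x ≠ 0 ∧ x ≠ 1 := by
  constructor
  · rintro rfl
    rw [zero_sub, v.map_neg] at hx
    exact absurd (lt_of_le_of_lt hx hthr.1) (lt_irrefl _)
  · rintro rfl
    have : v (1 - κ₀) = v (κ₀ - 1) := by rw [← v.map_neg, neg_sub]
    rw [this] at hx
    exact absurd (lt_of_le_of_lt hx hthr.2) (lt_irrefl _)

/-- CORE: for `N` large, everything within `q⁻¹ ^ N` of a regular `κ₀` is regular. -/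
theorem exists_regular_of_le_pow {q : ℝ} (hq : 1 < q) {κ₀ : K} (h0 : κ₀ ≠ 0) (h1 : κ₀ ≠ 1) :
    ∃ N₀ : ℕ, ∀ N ≥ N₀, ∀ x : K, v (x - κ₀) ≤ q⁻¹ ^ N → x ≠ 0 ∧ x ≠ 1 := by
  obtain ⟨N₀, hN₀⟩ := exists_threshold v hq h0 h1
  exact ⟨N₀, fun N hN x hx => ne_zero_and_ne_one_of_le_pow v (hN₀ N hN) hx⟩

end Core

section FinitePlace

open NumberField

variable {K : Type*} [Field K] [NumberField K]

/-- a finite place is an absolute value: the CORE at a finite place of a number field. -/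
theorem exists_regular_of_le_pow_finitePlace (w : FinitePlace K) {q : ℝ} (hq : 1 < q) {κ₀ : K}
    (h0 : κ₀ ≠ 0) (h1 : κ₀ ≠ 1) :
    ∃ N₀ : ℕ, ∀ N ≥ N₀, ∀ x : K, w (x - κ₀) ≤ q⁻¹ ^ N → x ≠ 0 ∧ x ≠ 1 := by
  have hκ0 : 0 < w κ₀ := FinitePlace.pos_iff.mpr h0
  have hκ1 : 0 < w (κ₀ - 1) := FinitePlace.pos_iff.mpr (sub_ne_zero.mpr h1)
  obtain ⟨N₀, hN₀⟩ := exists_pow_lt hq (lt_min hκ0 hκ1)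
  refine ⟨N₀, fun N hN x hx => ?_⟩
  have hthr := hN₀ N hN
  constructor
  · rintro rfl
    rw [zero_sub, map_neg_eq_map] at hx
    exact absurd (lt_of_le_of_lt hx (lt_of_lt_of_le hthr (min_le_left _ _))) (lt_irrefl _)
  · rintro rfl
    have : w (1 - κ₀) = w (κ₀ - 1) := by rw [← map_neg_eq_map w, neg_sub]
    rw [this] at hx
    exact absurd (lt_of_le_of_lt hx (lt_of_lt_of_le hthr (min_le_right _ _))) (lt_irrefl _)

end FinitePlace

section KappaData

open NumberField Summit.Ventures.HodgeRepro2.Tier7.Line3.DominantSideOfKappa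

variable {K : Type*} [Field K] [NumberField K] {Rep Orb : Type} [DecidableEq Orb] {PA PB : Rep → Prop}

/-- COROLLARY on the κ-dictionary: if the dominant coset `γ₀` is regular, the two singular double cosets
`κ ∈ {0, 1}` are outside the level-`N` support for `N` large — from the congruence field `hcong` alone. -/
theorem KappaData.exists_regular_of_arith (D : KappaData K Rep Orb PA PB)
    (h0 : D.κ D.γ₀ ≠ 0) (h1 : D.κ D.γ₀ ≠ 1) :
    ∃ N₀ : ℕ, ∀ N ≥ N₀, ∀ γ, D.arith N γ → D.κ γ ≠ 0 ∧ D.κ γ ≠ 1 := by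
  obtain ⟨N₀, hN₀⟩ := exists_regular_of_le_pow_finitePlace D.v₁ D.hq h0 h1
  exact ⟨N₀, fun N hN γ hγ => hN₀ N hN (D.κ γ) (D.hcong N γ hγ)⟩

/-- the same, as an `eventually` statement in the level `N`: every class of the level-`N` support is regular. -/
theorem KappaData.arith_regular_eventually (D : KappaData K Rep Orb PA PB)
    (h0 : D.κ D.γ₀ ≠ 0) (h1 : D.κ D.γ₀ ≠ 1) :
    ∀ᶠ N in atTop, ∀ γ, D.arith N γ → D.κ γ ≠ 0 ∧ D.κ γ ≠ 1 := by
  rw [Filter.eventually_atTop]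
  exact KappaData.exists_regular_of_arith D h0 h1

/-- no singular class carries a non-zero finite factor `b N γ` at level `N ≥ N₀` (`b_support`). -/
theorem KappaData.b_eq_zero_of_singular (D : KappaData K Rep Orb PA PB)
    (h0 : D.κ D.γ₀ ≠ 0) (h1 : D.κ D.γ₀ ≠ 1) :
    ∃ N₀ : ℕ, ∀ N ≥ N₀, ∀ γ, (D.κ γ = 0 ∨ D.κ γ = 1) → D.b N γ = 0 := by
  obtain ⟨N₀, hN₀⟩ := KappaData.exists_regular_of_arith D h0 h1
  refine ⟨N₀, fun N hN γ hγ => ?_⟩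
  by_contra hb
  have hreg := hN₀ N hN γ (D.b_support N γ hb)
  rcases hγ with h | h
  · exact hreg.1 h
  · exact hreg.2 h

end KappaData

section Isolation

open Summit.Ventures.HodgeRepro2.T7SupportTwoTorusInvariant
  Summit.Ventures.HodgeRepro2.Tier7.Line3.KappaNatural Summit.Ventures.HodgeRepro2.Tier7.Line3.KappaIsolation

variable {E E' : Type*} [Field E] [Field E'] (σ : E →+* E) (ψ : E →+* E') (d : Fin 2 → E)
  (f : Fin 2 → Fin 2 → E)

/-- the matrix-level invariant read in a completion `ψ` with an absolute value `abv` (the `hloc` shape of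
`KappaIsolation`): an `hcong`-type bound `abv (ψ (κ γ) − ψ (κ γ₀)) ≤ q⁻¹ ^ N` at a regular local value forces the
GLOBAL regularity of `γ` for `N` large — `KappaIsolation.map_kappa_ne_zero_iff` / `map_kappa_ne_one_iff`. -/
theorem exists_regular_of_map_kappa_le_pow (abv : AbsoluteValue E' ℝ) {q : ℝ} (hq : 1 < q)
    (γ₀ : Matrix (Fin 2) (Fin 2) E) (h0 : ψ (kappa σ d f γ₀) ≠ 0) (h1 : ψ (kappa σ d f γ₀) ≠ 1) :
    ∃ N₀ : ℕ, ∀ N ≥ N₀, ∀ γ : Matrix (Fin 2) (Fin 2) E,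
      abv (ψ (kappa σ d f γ) - ψ (kappa σ d f γ₀)) ≤ q⁻¹ ^ N →
        kappa σ d f γ ≠ 0 ∧ kappa σ d f γ ≠ 1 := by
  obtain ⟨N₀, hN₀⟩ := exists_regular_of_le_pow abv hq h0 h1
  refine ⟨N₀, fun N hN γ hγ => ?_⟩
  obtain ⟨hz, ho⟩ := hN₀ N hN _ hγ
  exact ⟨(map_kappa_ne_zero_iff σ ψ d f γ).1 hz, (map_kappa_ne_one_iff σ ψ d f γ).1 ho⟩

end Isolation

end Summit.Ventures.HodgeRepro2.Tier7.Line3.KappaSingularExcluded
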